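import Mathlib
import HarnessLib
import Summits.QuantumFields.YangMills.Theses.PencilRigidity

/-!
# `CurvatureKernelBound` — kernel pinning by real off-diagonal tensors (support for stmt-QuantumFields-11687)

Support file for crux `stmt-QuantumFields-11687` (`PencilRigidity.CurvatureKernelBound`), line
`sixteen-charts-analytic-kernel`.  Kernel-level bookkeeping shared by the line's stubs, stated
without auxiliary definitions (bump functions are built inside the proofs):

* `isOffDiagonal_tensorFin_two`, `tsupport_tensorFin_two_subset`, `hasCompactSupport_tensorFin_two`,
  `isTensorOf_tensorFin_two_ofRealTest`: the two-point tensor `f ⊗ g = SchwartzMap.tensorFin 2 ![f, g]`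
  of test functions with disjoint (compact) supports lies in `⁰𝒮`, is supported off the diagonal
  (compactly), and for real `f, g` is a real tensor in the sense of the crux's lattice clause;
* `kernel_eq_zero_of_realTensor`: **pinning** — a real kernel, continuous off `0`, whose two-point
  integrals against all compactly supported real off-diagonal tensors vanish, vanishes off `0`
  (normalised bumps shrinking to `(x₀, 0)` + continuity; adapted from the standing disprover's work
  file `Cruxes/CurvatureKernelBound/Disproof.lean` §C, refuter-cdisprove seat);
* `kernel_eq_zero_of_realTensor_complex`, `kernel_unique_of_realTensor`: the same for complex
  kernels, and uniqueness of a continuous-off-`0` representing kernel;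
* `LatticeReality`: Stub C of the line — a continuous-off-`0` kernel representing a two-point
  functional that is REAL on real off-diagonal tensors has vanishing imaginary part off `0`.
[folklore]
-/

noncomputable section

open scoped BigOperators Topology SchwartzMap ComplexConjugate
open MeasureTheory Filter Set
open Literature.MathematicalPhysics.QuantumLattice Literature.MathematicalPhysics.AQFT

namespace Summit.QuantumFields.YangMills.Theorems.CurvatureKernel

/-! ## Two-point tensors with separated supports -/

/-- `(f ⊗ g)(x) = f(x₀) g(x₁)` for the tree's `tensorFin 2`. [folklore] -/
theorem tensorFin_two_apply (f g : 𝓢((EuclideanSpace ℝ (Fin 4)), ℂ)) (x : Fin 2 → (EuclideanSpace ℝ (Fin 4))) :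
    SchwartzMap.tensorFin 2 ![f, g] x = f (x 0) * g (x 1) := by
  simp [Fin.prod_univ_two]

/-- The support of `f ⊗ g` lies in `supp f × supp g`. [folklore] -/
theorem tsupport_tensorFin_two_subset_prod (f g : 𝓢((EuclideanSpace ℝ (Fin 4)), ℂ)) :
    tsupport (SchwartzMap.tensorFin 2 ![f, g] : (Fin 2 → (EuclideanSpace ℝ (Fin 4))) → ℂ) ⊆
      {x | x 0 ∈ tsupport (f : (EuclideanSpace ℝ (Fin 4)) → ℂ) ∧ x 1 ∈ tsupport (g : (EuclideanSpace ℝ (Fin 4)) → ℂ)} := by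
  have hS : IsClosed {x : Fin 2 → (EuclideanSpace ℝ (Fin 4)) | x 0 ∈ tsupport (f : (EuclideanSpace ℝ (Fin 4)) → ℂ) ∧ x 1 ∈ tsupport (g : (EuclideanSpace ℝ (Fin 4)) → ℂ)} :=
    ((isClosed_tsupport _).preimage (continuous_apply 0)).inter
      ((isClosed_tsupport _).preimage (continuous_apply 1))
  refine closure_minimal (fun x hx => ?_) hS
  rw [Function.mem_support, tensorFin_two_apply] at hx
  obtain ⟨hf, hg⟩ := mul_ne_zero_iff.1 hx
  exact ⟨subset_tsupport _ hf, subset_tsupport _ hg⟩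

/-- Disjoint supports ⇒ `f ⊗ g` is supported off the diagonal `{x₀ = x₁}`. [folklore] -/
theorem tsupport_tensorFin_two_subset {f g : 𝓢((EuclideanSpace ℝ (Fin 4)), ℂ)}
    (h : Disjoint (tsupport (f : (EuclideanSpace ℝ (Fin 4)) → ℂ)) (tsupport (g : (EuclideanSpace ℝ (Fin 4)) → ℂ))) :
    tsupport (SchwartzMap.tensorFin 2 ![f, g] : (Fin 2 → (EuclideanSpace ℝ (Fin 4))) → ℂ) ⊆ {x : Fin 2 → (EuclideanSpace ℝ (Fin 4)) | x 0 ≠ x 1} := by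
  intro x hx h01
  obtain ⟨hf, hg⟩ := tsupport_tensorFin_two_subset_prod f g hx
  rw [h01] at hf
  exact Set.disjoint_left.1 h hf hg

/-- Disjoint supports ⇒ `f ⊗ g ∈ ⁰𝒮`. [folklore] -/
theorem isOffDiagonal_tensorFin_two {f g : 𝓢((EuclideanSpace ℝ (Fin 4)), ℂ)}
    (h : Disjoint (tsupport (f : (EuclideanSpace ℝ (Fin 4)) → ℂ)) (tsupport (g : (EuclideanSpace ℝ (Fin 4)) → ℂ))) :
    IsOffDiagonal (SchwartzMap.tensorFin 2 ![f, g]) := by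
  refine IsOffDiagonal.of_tsupport_subset fun x hx hloc => ?_
  obtain ⟨i, j, hij, hxij⟩ := hloc
  have h01 : x 0 = x 1 := by
    fin_cases i <;> fin_cases j
    · exact absurd rfl hij
    · exact hxij
    · exact hxij.symm
    · exact absurd rfl hij
  exact tsupport_tensorFin_two_subset h hx h01

/-- Compact supports ⇒ `f ⊗ g` has compact support. [folklore] -/
theorem hasCompactSupport_tensorFin_two {f g : 𝓢((EuclideanSpace ℝ (Fin 4)), ℂ)}
    (hf : HasCompactSupport (f : (EuclideanSpace ℝ (Fin 4)) → ℂ)) (hg : HasCompactSupport (g : (EuclideanSpace ℝ (Fin 4)) → ℂ)) :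
    HasCompactSupport (SchwartzMap.tensorFin 2 ![f, g] : (Fin 2 → (EuclideanSpace ℝ (Fin 4))) → ℂ) := by
  let B : Fin 2 → Set (EuclideanSpace ℝ (Fin 4)) := ![tsupport (f : (EuclideanSpace ℝ (Fin 4)) → ℂ), tsupport (g : (EuclideanSpace ℝ (Fin 4)) → ℂ)]
  have hK : IsCompact (Set.pi Set.univ B) := isCompact_univ_pi fun i => by
    fin_cases i
    · exact hf
    · exact hg
  refine HasCompactSupport.of_support_subset_isCompact hK fun x hx => ?_
  rw [Function.mem_support, tensorFin_two_apply] at hx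
  obtain ⟨hf', hg'⟩ := mul_ne_zero_iff.1 hx
  rw [Set.mem_univ_pi, Fin.forall_fin_two]
  exact ⟨subset_tsupport _ hf', subset_tsupport _ hg'⟩

/-- For real `f, g` the tensor `f ⊗ g` is a real tensor in the sense of the crux's lattice clause.
[folklore] -/
theorem isTensorOf_tensorFin_two_ofRealTest (f g : 𝓢((EuclideanSpace ℝ (Fin 4)), ℝ)) :
    IsTensorOf (SchwartzMap.tensorFin 2 ![ofRealTest f, ofRealTest g])
      (fun i => ofRealTest (![f, g] i)) := by
  intro x
  rw [SchwartzMap.tensorFin_apply]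
  refine Finset.prod_congr rfl fun i _ => ?_
  fin_cases i <;> rfl

/-! ## Pinning -/

/-- **Pinning lemma (real-tensor form).** A real kernel `K`, continuous off `0`, such that
`∫ K(x₀ - x₁) F(x) dx = 0` for every compactly supported real tensor `F = f ⊗ g` in `⁰𝒮` supported
off the diagonal, vanishes off `0`: test against normalised-shape bumps shrinking to `(x₀, 0)` and
use the continuity of `K` at `x₀ ≠ 0`. [folklore] -/
theorem kernel_eq_zero_of_realTensor (K : (EuclideanSpace ℝ (Fin 4)) → ℝ) (hK : ContinuousOn K {x : (EuclideanSpace ℝ (Fin 4)) | x ≠ 0})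
    (h0 : ∀ (f : Fin 2 → 𝓢((EuclideanSpace ℝ (Fin 4)), ℝ)) (F : 𝓢((Fin 2 → (EuclideanSpace ℝ (Fin 4))), ℂ)),
      IsTensorOf F (fun i => ofRealTest (f i)) → IsOffDiagonal F →
      HasCompactSupport (F : (Fin 2 → (EuclideanSpace ℝ (Fin 4))) → ℂ) →
      tsupport (F : (Fin 2 → (EuclideanSpace ℝ (Fin 4))) → ℂ) ⊆ {x : Fin 2 → (EuclideanSpace ℝ (Fin 4)) | x 0 ≠ x 1} →
      Integrable (fun x : Fin 2 → (EuclideanSpace ℝ (Fin 4)) => (K (x 0 - x 1) : ℂ) * F x) ∧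
        ∫ x : Fin 2 → (EuclideanSpace ℝ (Fin 4)), (K (x 0 - x 1) : ℂ) * F x = 0) :
    ∀ x : (EuclideanSpace ℝ (Fin 4)), x ≠ 0 → K x = 0 := by
  intro x₀ hx₀
  by_contra hne
  set κ := K x₀ with hκdef
  have hκ : 0 < |κ| := abs_pos.2 hne
  have hopen : IsOpen {x : (EuclideanSpace ℝ (Fin 4)) | x ≠ 0} := isOpen_compl_singleton
  have hcont : ContinuousAt K x₀ := (hK x₀ hx₀).continuousAt (hopen.mem_nhds hx₀)
  obtain ⟨ρ, hρ, hρK⟩ := Metric.continuousAt_iff.1 hcont (|κ| / 2) (half_pos hκ)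
  have hn0 : 0 < ‖x₀‖ := norm_pos_iff.2 hx₀
  set r : ℝ := min (ρ / 4) (‖x₀‖ / 4) with hrdef
  have hr : 0 < r := lt_min (by linarith) (by linarith)
  have hrρ : r ≤ ρ / 4 := min_le_left _ _
  have hrx : r ≤ ‖x₀‖ / 4 := min_le_right _ _
  let g : ContDiffBump x₀ := ⟨r / 2, r, by linarith, by linarith⟩
  let h : ContDiffBump (0 : (EuclideanSpace ℝ (Fin 4))) := ⟨r / 2, r, by linarith, by linarith⟩
  -- the real test functions and their tensor
  let gS : 𝓢((EuclideanSpace ℝ (Fin 4)), ℝ) := g.hasCompactSupport.toSchwartzMap g.contDiff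
  let hS : 𝓢((EuclideanSpace ℝ (Fin 4)), ℝ) := h.hasCompactSupport.toSchwartzMap h.contDiff
  have gS_apply : ∀ x, gS x = g x := fun _ => rfl
  have hS_apply : ∀ x, hS x = h x := fun _ => rfl
  let F : 𝓢((Fin 2 → (EuclideanSpace ℝ (Fin 4))), ℂ) := SchwartzMap.tensorFin 2 ![ofRealTest gS, ofRealTest hS]
  have F_apply : ∀ x : Fin 2 → (EuclideanSpace ℝ (Fin 4)), F x = ((g (x 0) * h (x 1) : ℝ) : ℂ) := by
    intro x
    rw [tensorFin_two_apply, ofRealTest_apply, ofRealTest_apply, gS_apply, hS_apply]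
    push_cast; rfl
  -- supports
  have htg : tsupport (ofRealTest gS : (EuclideanSpace ℝ (Fin 4)) → ℂ) ⊆ Metric.closedBall x₀ r := by
    have hs : Function.support (ofRealTest gS : (EuclideanSpace ℝ (Fin 4)) → ℂ) = Function.support (g : (EuclideanSpace ℝ (Fin 4)) → ℝ) := by
      ext y; simp [ofRealTest_apply, gS_apply]
    have ht : tsupport (g : (EuclideanSpace ℝ (Fin 4)) → ℝ) = Metric.closedBall x₀ r := g.tsupport_eq
    change closure (Function.support _) ⊆ _
    rw [hs]
    exact ht.subset
  have hth : tsupport (ofRealTest hS : (EuclideanSpace ℝ (Fin 4)) → ℂ) ⊆ Metric.closedBall (0 : (EuclideanSpace ℝ (Fin 4))) r := by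
    have hs : Function.support (ofRealTest hS : (EuclideanSpace ℝ (Fin 4)) → ℂ) = Function.support (h : (EuclideanSpace ℝ (Fin 4)) → ℝ) := by
      ext y; simp [ofRealTest_apply, hS_apply]
    have ht : tsupport (h : (EuclideanSpace ℝ (Fin 4)) → ℝ) = Metric.closedBall (0 : (EuclideanSpace ℝ (Fin 4))) r := h.tsupport_eq
    change closure (Function.support _) ⊆ _
    rw [hs]
    exact ht.subset
  have hdisj : Disjoint (tsupport (ofRealTest gS : (EuclideanSpace ℝ (Fin 4)) → ℂ)) (tsupport (ofRealTest hS : (EuclideanSpace ℝ (Fin 4)) → ℂ)) := by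
    refine Set.disjoint_left.2 fun x hxg hxh => ?_
    have h1 := htg hxg; have h2 := hth hxh
    rw [Metric.mem_closedBall, dist_eq_norm] at h1 h2
    rw [sub_zero] at h2
    have : ‖x₀‖ ≤ ‖x₀ - x‖ + ‖x‖ := by
      calc ‖x₀‖ = ‖(x₀ - x) + x‖ := by rw [sub_add_cancel]
        _ ≤ ‖x₀ - x‖ + ‖x‖ := norm_add_le _ _
    rw [norm_sub_rev] at this
    linarith
  have hcg : HasCompactSupport (ofRealTest gS : (EuclideanSpace ℝ (Fin 4)) → ℂ) :=
    HasCompactSupport.of_support_subset_isCompact (isCompact_closedBall x₀ r)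
      ((subset_tsupport _).trans htg)
  have hch : HasCompactSupport (ofRealTest hS : (EuclideanSpace ℝ (Fin 4)) → ℂ) :=
    HasCompactSupport.of_support_subset_isCompact (isCompact_closedBall (0 : (EuclideanSpace ℝ (Fin 4))) r)
      ((subset_tsupport _).trans hth)
  obtain ⟨hint, hI⟩ := h0 ![gS, hS] F
    (by simpa using isTensorOf_tensorFin_two_ofRealTest gS hS)
    (isOffDiagonal_tensorFin_two hdisj) (hasCompactSupport_tensorFin_two hcg hch)
    (tsupport_tensorFin_two_subset hdisj)
  set fR : (Fin 2 → (EuclideanSpace ℝ (Fin 4))) → ℝ := fun x => K (x 0 - x 1) * (g (x 0) * h (x 1)) with hfR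
  have hfun : (fun x : Fin 2 → (EuclideanSpace ℝ (Fin 4)) => (K (x 0 - x 1) : ℂ) * F x) = fun x => ((fR x : ℝ) : ℂ) := by
    funext x; rw [F_apply]; push_cast; simp [fR]
  rw [hfun] at hint hI
  have hintR : Integrable fR := by
    have := hint.re
    simpa using this
  have hIR : ∫ x, fR x = 0 := by
    have h1 : ((∫ x, fR x : ℝ) : ℂ) = 0 := by rw [← integral_complex_ofReal]; exact hI
    exact_mod_cast h1
  set ℓ : (Fin 2 → (EuclideanSpace ℝ (Fin 4))) → ℝ := fun x => κ ^ 2 / 2 * (g (x 0) * h (x 1)) with hℓ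
  have hℓ_le : ∀ x, ℓ x ≤ κ * fR x := by
    intro x
    by_cases hgh : g (x 0) * h (x 1) = 0
    · simp [ℓ, fR, hgh]
    obtain ⟨hg1, hh1⟩ := mul_ne_zero_iff.1 hgh
    have hg2 : x 0 ∈ Metric.ball x₀ r := by
      have : x 0 ∈ Function.support g := hg1
      rwa [ContDiffBump.support_eq] at this
    have hh2 : x 1 ∈ Metric.ball (0 : (EuclideanSpace ℝ (Fin 4))) r := by
      have : x 1 ∈ Function.support h := hh1
      rwa [ContDiffBump.support_eq] at this
    rw [Metric.mem_ball, dist_eq_norm] at hg2 hh2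
    rw [sub_zero] at hh2
    have hd : dist (x 0 - x 1) x₀ < ρ := by
      rw [dist_eq_norm]
      calc ‖x 0 - x 1 - x₀‖ = ‖(x 0 - x₀) - x 1‖ := by congr 1; abel
        _ ≤ ‖x 0 - x₀‖ + ‖x 1‖ := norm_sub_le _ _
        _ < r + r := add_lt_add hg2 hh2
        _ ≤ ρ := by linarith
    have hKx := hρK hd
    rw [Real.dist_eq] at hKx
    have hprod : 0 ≤ g (x 0) * h (x 1) := mul_nonneg g.nonneg h.nonneg
    have hkey : κ ^ 2 / 2 ≤ κ * K (x 0 - x 1) := by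
      have h1 : |κ| * |K (x 0 - x 1) - κ| ≤ |κ| * (|κ| / 2) :=
        mul_le_mul_of_nonneg_left hKx.le (abs_nonneg _)
      have h2 : -(|κ| * |K (x 0 - x 1) - κ|) ≤ κ * (K (x 0 - x 1) - κ) := by
        rw [← abs_mul]; exact neg_abs_le _
      have h3 : |κ| * |κ| = κ ^ 2 := by rw [← sq, sq_abs]
      nlinarith
    calc ℓ x = κ ^ 2 / 2 * (g (x 0) * h (x 1)) := rfl
      _ ≤ κ * K (x 0 - x 1) * (g (x 0) * h (x 1)) := mul_le_mul_of_nonneg_right hkey hprod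
      _ = κ * fR x := by simp [fR]; ring
  have hℓ_cont : Continuous ℓ :=
    continuous_const.mul ((g.continuous.comp (continuous_apply 0)).mul
      (h.continuous.comp (continuous_apply 1)))
  have hℓ_supp : HasCompactSupport ℓ := by
    let B : Fin 2 → Set (EuclideanSpace ℝ (Fin 4)) := ![Metric.closedBall x₀ r, Metric.closedBall (0 : (EuclideanSpace ℝ (Fin 4))) r]
    refine HasCompactSupport.intro (K := Set.pi Set.univ B)
      (isCompact_univ_pi fun i => ?_) ?_
    · fin_cases i <;> exact isCompact_closedBall _ _
    · intro x hx
      rw [Set.mem_univ_pi, Fin.forall_fin_two] at hx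
      simp only [ℓ]
      have : g (x 0) * h (x 1) = 0 := by
        by_contra hgh
        obtain ⟨hg1, hh1⟩ := mul_ne_zero_iff.1 hgh
        have hg2 : x 0 ∈ Function.support g := hg1
        have hh2 : x 1 ∈ Function.support h := hh1
        rw [ContDiffBump.support_eq] at hg2 hh2
        exact hx ⟨Metric.ball_subset_closedBall hg2, Metric.ball_subset_closedBall hh2⟩
      rw [this, mul_zero]
  have hℓ_nonneg : 0 ≤ ℓ := fun x => by
    simp only [ℓ, Pi.zero_apply]; exact mul_nonneg (by positivity) (mul_nonneg g.nonneg h.nonneg)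
  let xs : Fin 2 → (EuclideanSpace ℝ (Fin 4)) := ![x₀, 0]
  have hℓ_xs : ℓ xs ≠ 0 := by
    have hg1 : g (xs 0) = 1 := g.one_of_mem_closedBall (by simpa [xs, g] using (half_pos hr).le)
    have hh1 : h (xs 1) = 1 := h.one_of_mem_closedBall (by simpa [xs, h] using (half_pos hr).le)
    simp only [ℓ, hg1, hh1, mul_one]
    positivity
  have hpos : 0 < ∫ x, ℓ x :=
    hℓ_cont.integral_pos_of_hasCompactSupport_nonneg_nonzero hℓ_supp hℓ_nonneg hℓ_xs
  have hle : ∫ x, ℓ x ≤ ∫ x, κ * fR x :=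
    integral_mono_of_nonneg (Eventually.of_forall hℓ_nonneg) (hintR.const_mul κ)
      (Eventually.of_forall hℓ_le)
  have hzero : ∫ x, κ * fR x = 0 := by rw [integral_const_mul, hIR, mul_zero]
  linarith [hle, hzero, hpos]

/-- **Pinning for complex kernels.** A complex kernel, continuous off `0`, whose two-point
integrals against every compactly supported real off-diagonal tensor vanish, vanishes off `0`
(real and imaginary parts separately, the tensors being real). [folklore] -/
theorem kernel_eq_zero_of_realTensor_complex (K : (EuclideanSpace ℝ (Fin 4)) → ℂ) (hK : ContinuousOn K {x : (EuclideanSpace ℝ (Fin 4)) | x ≠ 0})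
    (h0 : ∀ (f : Fin 2 → 𝓢((EuclideanSpace ℝ (Fin 4)), ℝ)) (F : 𝓢((Fin 2 → (EuclideanSpace ℝ (Fin 4))), ℂ)),
      IsTensorOf F (fun i => ofRealTest (f i)) → IsOffDiagonal F →
      HasCompactSupport (F : (Fin 2 → (EuclideanSpace ℝ (Fin 4))) → ℂ) →
      tsupport (F : (Fin 2 → (EuclideanSpace ℝ (Fin 4))) → ℂ) ⊆ {x : Fin 2 → (EuclideanSpace ℝ (Fin 4)) | x 0 ≠ x 1} →
      Integrable (fun x : Fin 2 → (EuclideanSpace ℝ (Fin 4)) => K (x 0 - x 1) * F x) ∧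
        ∫ x : Fin 2 → (EuclideanSpace ℝ (Fin 4)), K (x 0 - x 1) * F x = 0) :
    ∀ x : (EuclideanSpace ℝ (Fin 4)), x ≠ 0 → K x = 0 := by
  -- a real tensor is pointwise real
  have hFreal : ∀ (f : Fin 2 → 𝓢((EuclideanSpace ℝ (Fin 4)), ℝ)) (F : 𝓢((Fin 2 → (EuclideanSpace ℝ (Fin 4))), ℂ)),
      IsTensorOf F (fun i => ofRealTest (f i)) → ∀ x, F x = ((F x).re : ℂ) := by
    intro f F hF x
    rw [hF x, Fin.prod_univ_two, ofRealTest_apply, ofRealTest_apply]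
    simp
  have hre : ∀ x : (EuclideanSpace ℝ (Fin 4)), x ≠ 0 → (K x).re = 0 := by
    refine kernel_eq_zero_of_realTensor (fun x => (K x).re)
      (Complex.continuous_re.comp_continuousOn hK) fun f F hF hoff hc hts => ?_
    obtain ⟨hint, hI⟩ := h0 f F hF hoff hc hts
    have hfun : (fun x : Fin 2 → (EuclideanSpace ℝ (Fin 4)) => (((K (x 0 - x 1)).re : ℝ) : ℂ) * F x) =
        fun x => (((K (x 0 - x 1) * F x).re : ℝ) : ℂ) := by
      funext x; rw [hFreal f F hF x, Complex.mul_re]; simp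
    rw [hfun]
    refine ⟨hint.re.ofReal, ?_⟩
    have h := integral_re hint
    simp only [RCLike.re_to_complex] at h
    rw [integral_complex_ofReal, h, hI]; simp
  have him : ∀ x : (EuclideanSpace ℝ (Fin 4)), x ≠ 0 → (K x).im = 0 := by
    refine kernel_eq_zero_of_realTensor (fun x => (K x).im)
      (Complex.continuous_im.comp_continuousOn hK) fun f F hF hoff hc hts => ?_
    obtain ⟨hint, hI⟩ := h0 f F hF hoff hc hts
    have hfun : (fun x : Fin 2 → (EuclideanSpace ℝ (Fin 4)) => (((K (x 0 - x 1)).im : ℝ) : ℂ) * F x) =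
        fun x => (((K (x 0 - x 1) * F x).im : ℝ) : ℂ) := by
      funext x; rw [hFreal f F hF x, Complex.mul_im]; simp
    rw [hfun]
    refine ⟨hint.im.ofReal, ?_⟩
    have h := integral_im hint
    simp only [RCLike.im_to_complex] at h
    rw [integral_complex_ofReal, h, hI]; simp
  intro x hx
  exact Complex.ext (by simpa using hre x hx) (by simpa using him x hx)

/-- **Kernel uniqueness.** Two complex kernels continuous off `0` with the same two-point integrals
against every compactly supported real off-diagonal tensor agree off `0`. [folklore] -/
theorem kernel_unique_of_realTensor {K K' : (EuclideanSpace ℝ (Fin 4)) → ℂ}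
    (hK : ContinuousOn K {x : (EuclideanSpace ℝ (Fin 4)) | x ≠ 0}) (hK' : ContinuousOn K' {x : (EuclideanSpace ℝ (Fin 4)) | x ≠ 0})
    (h : ∀ (f : Fin 2 → 𝓢((EuclideanSpace ℝ (Fin 4)), ℝ)) (F : 𝓢((Fin 2 → (EuclideanSpace ℝ (Fin 4))), ℂ)),
      IsTensorOf F (fun i => ofRealTest (f i)) → IsOffDiagonal F →
      HasCompactSupport (F : (Fin 2 → (EuclideanSpace ℝ (Fin 4))) → ℂ) →
      tsupport (F : (Fin 2 → (EuclideanSpace ℝ (Fin 4))) → ℂ) ⊆ {x : Fin 2 → (EuclideanSpace ℝ (Fin 4)) | x 0 ≠ x 1} →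
      Integrable (fun x : Fin 2 → (EuclideanSpace ℝ (Fin 4)) => K (x 0 - x 1) * F x) ∧
      Integrable (fun x : Fin 2 → (EuclideanSpace ℝ (Fin 4)) => K' (x 0 - x 1) * F x) ∧
        ∫ x : Fin 2 → (EuclideanSpace ℝ (Fin 4)), K (x 0 - x 1) * F x = ∫ x : Fin 2 → (EuclideanSpace ℝ (Fin 4)), K' (x 0 - x 1) * F x) :
    ∀ x : (EuclideanSpace ℝ (Fin 4)), x ≠ 0 → K x = K' x := by
  have hz := kernel_eq_zero_of_realTensor_complex (fun x => K x - K' x) (hK.sub hK')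
    (fun f F hF hoff hc hts => by
      obtain ⟨h1, h1', h2⟩ := h f F hF hoff hc hts
      have hfun : (fun x : Fin 2 → (EuclideanSpace ℝ (Fin 4)) => (fun x => K x - K' x) (x 0 - x 1) * F x) =
          fun x => K (x 0 - x 1) * F x - K' (x 0 - x 1) * F x := by
        funext x; ring
      refine ⟨by rw [hfun]; exact h1.sub h1', ?_⟩
      rw [hfun, integral_sub h1 h1', h2, sub_self])
  intro x hx
  exact sub_eq_zero.1 (hz x hx)

/-! ## Stub C · `LatticeReality` -/

/-- **`LatticeReality`** (Stub C of line `sixteen-charts-analytic-kernel`, crux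
`PencilRigidity.CurvatureKernelBound`, registered signature verbatim): a kernel `K : ℝ⁴ → ℂ`
continuous off `0` representing a two-point functional on `⁰𝒮` that is REAL on real off-diagonal
tensors `f₀ ⊗ f₁` has `Im K = 0` off `0` (pinning applied to `Im K`: on a real tensor `F`,
`Im (K·F) = (Im K)·F`, so `∫ (Im K)(x₀-x₁) F = Im 𝔖₂(F) = 0`). In the line's composition the reality
hypothesis is the first clause of `W₁` at `n = 2` (a limit of real lattice correlations).
[folklore] -/
theorem LatticeReality : open Literature.MathematicalPhysics.QuantumLattice Literature.MathematicalPhysics.AQFT Literature.MathematicalPhysics.QuantumFieldTheory in ∀ (S₁ : SchwingerFamily (EuclideanSpace ℝ (Fin 4))) (K : (EuclideanSpace ℝ (Fin 4)) → ℂ), ContinuousOn K {x : (EuclideanSpace ℝ (Fin 4)) | x ≠ 0} → (∀ F : SchwartzMap (Fin 2 → (EuclideanSpace ℝ (Fin 4))) ℂ, IsOffDiagonal F → MeasureTheory.Integrable (fun x : Fin 2 → (EuclideanSpace ℝ (Fin 4)) => K (x 0 - x 1) * F x) ∧ S₁ 2 F = ∫ x : Fin 2 → (EuclideanSpace ℝ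 (Fin 4)), K (x 0 - x 1) * F x) → (∀ (f : Fin 2 → SchwartzMap (EuclideanSpace ℝ (Fin 4)) ℝ) (F : SchwartzMap (Fin 2 → (EuclideanSpace ℝ (Fin 4))) ℂ), IsTensorOf F (fun i => ofRealTest (f i)) → IsOffDiagonal F → (S₁ 2 F).im = 0) → ∀ x : (EuclideanSpace ℝ (Fin 4)), x ≠ 0 → (K x).im = 0 := by
  intro S₁ K hcont hrep hreal
  -- a real tensor is pointwise real
  have hFreal : ∀ (f : Fin 2 → 𝓢((EuclideanSpace ℝ (Fin 4)), ℝ)) (F : 𝓢((Fin 2 → (EuclideanSpace ℝ (Fin 4))), ℂ)),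
      IsTensorOf F (fun i => ofRealTest (f i)) → ∀ x, F x = ((F x).re : ℂ) := by
    intro f F hF x
    rw [hF x, Fin.prod_univ_two, ofRealTest_apply, ofRealTest_apply]
    simp
  refine kernel_eq_zero_of_realTensor (fun x => (K x).im)
    (Complex.continuous_im.comp_continuousOn hcont) fun f F hF hoff _ _ => ?_
  obtain ⟨hint, hSF⟩ := hrep F hoff
  have him0 : (S₁ 2 F).im = 0 := hreal f F hF hoff
  have hfun : (fun x : Fin 2 → (EuclideanSpace ℝ (Fin 4)) => (((K (x 0 - x 1)).im : ℝ) : ℂ) * F x) =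
      fun x => (((K (x 0 - x 1) * F x).im : ℝ) : ℂ) := by
    funext x; rw [hFreal f F hF x, Complex.mul_im]; simp
  rw [hfun]
  refine ⟨hint.im.ofReal, ?_⟩
  have h := integral_im hint
  simp only [RCLike.im_to_complex] at h
  rw [integral_complex_ofReal, h, ← hSF, him0]; simp

end Summit.QuantumFields.YangMills.Theorems.CurvatureKernel

end
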